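import Literature.Probability.Percolation.GladkovThreeClusterDichotomyProofs
import Mathlib.Tactic.FieldSimp
import Mathlib.Tactic.Linarith
import Mathlib.Tactic.Ring
import HarnessLib

/-!
# The three-point variance row `(3PT)` in the Gladkov regime — every finite weighted graph

Support file for crux `stmt-CriticalPhenomena-4575` (`NoHeavyLowerTail`), seat `prim-l12-p1` gen 17
(`--supports stmt-CriticalPhenomena-4575`).  Memo `run/shared/lean/prim/prim-l12/FROM-prim-l12-p1-g17-GLADKOV-REGIME.md`.

Bond percolation `μ = prodBernoulli w` (arbitrary pair weights, finite vertex type `V`), vertices `a b c`, cells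
`x = μ(abc)`, `s = μ(ab|c)`, `t = μ(ac|b)`, `u = μ(a|bc)`, `q = μ(a|b|c)`, `θ = μ(a↔b) = x + s`,
`1 − θ = q + t + u`.  The row under study (gen 15/16; kernel for `n ≤ 5`; proved ∀n on the classes of
`…ThreePointVarianceTwoNeighbours/CutVertex/BehindCutVertex/Isolation`; conjectured ∀n) is

  `(3PT)   θ(1 − θ) ≤ s + t + u`,   equivalently   `q·θ ≤ s + (t + u)(1 − θ)`.

THIS FILE proves `(3PT)` on EVERY finite weighted graph under ONE explicit hypothesis on the five-cell law,
as a corollary of Gladkov's Lemma 1.2 (tree: `gladkov2024_lemma_1_2_prodBernoulli`,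
`q²/μ(b isolated) + q²/μ(c isolated) ≤ q + μ(a isolated)²` [cite: Gladkov2024, Lemma 1.2]):

* `threePointVariance_of_regime_t`: if `q·t/(q+t) ≤ s²/(q+s) + t·(1−θ)` then `(3PT)`;
* `threePointVariance_of_regime_u`: if `q·u/(q+u) ≤ s²/(q+s) + u·(1−θ)` then `(3PT)` (the `a ↔ b` mirror,
  from Lemma 1.2 at the vertex `b`).
Here `q + t = μ(b ↮ a, b ↮ c)`, `q + s = μ(c ↮ a, c ↮ b)`; divisions are Lean's total division (a vanishing
denominator makes the corresponding term `0`, and both statements remain true in that degenerate case).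

ALGEBRA (`regime_algebra`).  With `B = q + t`, `C = q + s`, `A = q + u` (the three isolation probabilities),
Lemma 1.2 at `a` reads `q²/B + q²/C ≤ q + A²`, i.e. `q − A² ≤ qs/C + qt/B`; since `θ ≤ 1 − A` this gives
`qθ ≤ qs/C + qt/B + u(1−θ)`; the hypothesis replaces `qt/B` by `s²/C + t(1−θ)` and `qs/C + s²/C = s`.

SCOPE (numbers, memo §2–§3): no realizable law violating the hypothesis with `v = max(t,u)` in place of `t`
was found (hill-climb over all edge weights on ≈ 200 graphs with `≤ 8` vertices, and the hub families
`H_k`, `k ≤ 10³`, which carry the sharp constant of `(3PT)`); the `n = 103` point refuting the martingale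
sharpening `(3PT-M)` and the whole extremal hub line lie inside the proved regime.  The hypothesis is NOT
implied at law level by the proved three-point bank (Harris, GZ Thm 4.6 and its computer version,
Aas–Gladkov, Lemma 1.2 in all rotations): the simplex point `(x,s,t,u,q) = (0.841, 0.0105, 0.054, 0.054,
0.0403)` satisfies all of them and violates `(3PT)`.  Nothing is claimed about laws outside the regime.

Main results: `regime_algebra`, `cells_eq`, `threePointVariance_of_regime_t`, `threePointVariance_of_regime_u`.
-/

namespace Summit.CriticalPhenomena.PercolationContinuityZ3.Theorems.ThreePointVarianceGladkovRegime

open MeasureTheory Set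
open Literature.Probability.Percolation Literature.Probability.LatticeModels

/-- **The algebra of the regime corollary.**  For nonnegative reals `s t u q` and real `θ` with `θ + t + u + q = 1`
(so `1 − θ = q + t + u`), Gladkov's Lemma 1.2 at `a` (`q²/(q+t) + q²/(q+s) ≤ q + (q+u)²`) together with
the regime hypothesis `q t/(q+t) ≤ s²/(q+s) + t(1−θ)` gives `θ(1−θ) ≤ s + t + u`.  Divisions are total
(`x/0 = 0`). [this work] -/
theorem regime_algebra {θ s t u q : ℝ} (hs : 0 ≤ s) (ht : 0 ≤ t) (hu : 0 ≤ u) (hq : 0 ≤ q)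
    (hsum : θ + t + u + q = 1)
    (hL : q ^ 2 / (q + t) + q ^ 2 / (q + s) ≤ q + (q + u) ^ 2)
    (hR : q * t / (q + t) ≤ s ^ 2 / (q + s) + t * (1 - θ)) :
    θ * (1 - θ) ≤ s + t + u := by
  have h1θ : 1 - θ = q + t + u := by linarith
  by_cases hC : q + s = 0
  · -- `q = s = 0`: `θ(1−θ) = θ(t+u) ≤ t + u`
    have hq0 : q = 0 := by linarith
    have hs0 : s = 0 := by linarith
    have hθ1 : θ ≤ 1 := by linarith
    rw [h1θ, hq0, hs0]
    nlinarith [mul_le_mul_of_nonneg_right hθ1 (add_nonneg ht hu)]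
  by_cases hB : q + t = 0
  · -- `q = t = 0`: `θ(1−θ) = θu ≤ u`
    have hq0 : q = 0 := by linarith
    have ht0 : t = 0 := by linarith
    have hθ1 : θ ≤ 1 := by linarith
    rw [h1θ, hq0, ht0]
    nlinarith [mul_le_mul_of_nonneg_right hθ1 hu]
  have hC' : 0 < q + s := lt_of_le_of_ne (add_nonneg hq hs) (Ne.symm hC)
  have hB' : 0 < q + t := lt_of_le_of_ne (add_nonneg hq ht) (Ne.symm hB)
  have e1 : q ^ 2 / (q + s) = q - q * s / (q + s) := by
    rw [eq_sub_iff_add_eq, ← add_div, div_eq_iff (ne_of_gt hC')]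
    ring
  have e2 : q ^ 2 / (q + t) = q - q * t / (q + t) := by
    rw [eq_sub_iff_add_eq, ← add_div, div_eq_iff (ne_of_gt hB')]
    ring
  have e3 : q * s / (q + s) + s ^ 2 / (q + s) = s := by
    rw [← add_div, div_eq_iff (ne_of_gt hC')]
    ring
  -- Lemma 1.2 rearranged: `q − (q+u)² ≤ qs/(q+s) + qt/(q+t)`
  have h1 : q - (q + u) ^ 2 ≤ q * s / (q + s) + q * t / (q + t) := by
    rw [e1, e2] at hL
    linarith
  -- `θ ≤ 1 − (q+u)` hence `(q+u)θ ≤ (q+u)(1−(q+u))`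
  have hA : θ ≤ 1 - (q + u) := by linarith
  have h2 : (q + u) * θ ≤ (q + u) * (1 - (q + u)) := mul_le_mul_of_nonneg_left hA (add_nonneg hq hu)
  -- `qθ ≤ qs/(q+s) + qt/(q+t) + u(1−θ)`
  have h3 : q * θ ≤ q * s / (q + s) + q * t / (q + t) + u * (1 - θ) := by nlinarith [h1, h2]
  -- insert the regime hypothesis
  have h4 : q * θ ≤ s + (t + u) * (1 - θ) := by nlinarith [h3, hR, e3]
  have h5 : θ * (1 - θ) = q * θ + (t + u) * θ := by
    rw [h1θ]
    ring
  rw [h5]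
  nlinarith [h4]

variable {V : Type*} [Fintype V]

/-- The five-cell bookkeeping: all cells and isolation probabilities of three vertices in terms of
`μ(a↔b), μ(a↔c), μ(b↔c), μ(abc)`. [folklore] -/
theorem cells_eq (w : Sym2 V → unitInterval) (a b c : V) :
    let μ := prodBernoulli w
    μ.real (openConn a b ∩ openConn b c) = μ.real (openConn a b ∩ openConn a c) ∧
    μ.real (openConn a c ∩ openConn b c) = μ.real (openConn a b ∩ openConn a c) ∧
    μ.real (openConn a b)ᶜ = 1 - μ.real (openConn a b) ∧
    μ.real (openConn a b ∩ (openConn a c)ᶜ) = μ.real (openConn a b) - μ.real (openConn a b ∩ openConn a c) ∧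
    μ.real (openConn a c ∩ (openConn a b)ᶜ) = μ.real (openConn a c) - μ.real (openConn a b ∩ openConn a c) ∧
    μ.real (openConn b c ∩ (openConn a b)ᶜ) = μ.real (openConn b c) - μ.real (openConn a b ∩ openConn a c) ∧
    μ.real ((openConn a b)ᶜ ∩ (openConn a c)ᶜ) =
      1 - μ.real (openConn a b) - μ.real (openConn a c) + μ.real (openConn a b ∩ openConn a c) ∧
    μ.real ((openConn a b)ᶜ ∩ (openConn b c)ᶜ) =
      1 - μ.real (openConn a b) - μ.real (openConn b c) + μ.real (openConn a b ∩ openConn a c) ∧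
    μ.real ((openConn a c)ᶜ ∩ (openConn b c)ᶜ) =
      1 - μ.real (openConn a c) - μ.real (openConn b c) + μ.real (openConn a b ∩ openConn a c) ∧
    μ.real ((openConn a b)ᶜ ∩ (openConn a c)ᶜ ∩ (openConn b c)ᶜ) =
      1 - μ.real (openConn a b) - μ.real (openConn a c) - μ.real (openConn b c) +
        2 * μ.real (openConn a b ∩ openConn a c) := by
  classical
  intro μ
  set Eab : Set (BondConfig V) := openConn a b with hEab
  set Eac : Set (BondConfig V) := openConn a c with hEac
  set Ebc : Set (BondConfig V) := openConn b c with hEbc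
  have mEab : MeasurableSet Eab := MeasurableSet.of_discrete
  have mEac : MeasurableSet Eac := MeasurableSet.of_discrete
  have mEbc : MeasurableSet Ebc := MeasurableSet.of_discrete
  set T : Set (BondConfig V) := Eab ∩ Eac with hT
  have hT₁ : Eab ∩ Ebc = T := by
    ext ω
    constructor
    · rintro ⟨hab, hbc⟩
      exact ⟨hab, SimpleGraph.Reachable.trans hab hbc⟩
    · rintro ⟨hab, hac⟩
      exact ⟨hab, SimpleGraph.Reachable.trans (SimpleGraph.Reachable.symm hab) hac⟩
  have hT₂ : Eac ∩ Ebc = T := by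
    ext ω
    constructor
    · rintro ⟨hac, hbc⟩
      exact ⟨SimpleGraph.Reachable.trans hac (SimpleGraph.Reachable.symm hbc), hac⟩
    · rintro ⟨hab, hac⟩
      exact ⟨hac, SimpleGraph.Reachable.trans (SimpleGraph.Reachable.symm hab) hac⟩
  set x := μ.real Eab with hx
  set y := μ.real Eac with hy
  set z := μ.real Ebc with hz
  set tt := μ.real T with htt
  have hU : μ.real (Eab ∪ Eac) = x + y - tt := by
    have h := measureReal_union_add_inter (μ := μ) (s := Eab) mEac
    linarith
  have hU3 : μ.real (Eab ∪ Eac ∪ Ebc) = x + y + z - 2 * tt := by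
    have h := measureReal_union_add_inter (μ := μ) (s := Eab ∪ Eac) mEbc
    have hI : (Eab ∪ Eac) ∩ Ebc = T := by
      rw [Set.union_inter_distrib_right, hT₁, hT₂, Set.union_self]
    rw [hI] at h
    linarith
  have cA : μ.real Eabᶜ = 1 - x := probReal_compl_eq_one_sub mEab
  have cAB : μ.real (Eabᶜ ∩ Eacᶜ) = 1 - x - y + tt := by
    rw [← Set.compl_union, probReal_compl_eq_one_sub (mEab.union mEac), hU]
    ring
  have cAC : μ.real (Eabᶜ ∩ Ebcᶜ) = 1 - x - z + tt := by
    have h := measureReal_union_add_inter (μ := μ) (s := Eab) mEbc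
    rw [hT₁] at h
    rw [← Set.compl_union, probReal_compl_eq_one_sub (mEab.union mEbc)]
    linarith
  have cBC : μ.real (Eacᶜ ∩ Ebcᶜ) = 1 - y - z + tt := by
    have h := measureReal_union_add_inter (μ := μ) (s := Eac) mEbc
    rw [hT₂] at h
    rw [← Set.compl_union, probReal_compl_eq_one_sub (mEac.union mEbc)]
    linarith
  have cQ : μ.real (Eabᶜ ∩ Eacᶜ ∩ Ebcᶜ) = 1 - x - y - z + 2 * tt := by
    rw [← Set.compl_union, ← Set.compl_union,
      probReal_compl_eq_one_sub ((mEab.union mEac).union mEbc), hU3]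
    ring
  have u₃ : μ.real (Eab ∩ Eacᶜ) = x - tt := by
    have h := measureReal_inter_add_sdiff (μ := μ) (s := Eab) mEac
    rw [Set.sdiff_eq] at h
    linarith
  have u₂ : μ.real (Eac ∩ Eabᶜ) = y - tt := by
    have h := measureReal_inter_add_sdiff (μ := μ) (s := Eac) mEab
    rw [Set.sdiff_eq, Set.inter_comm Eac Eab] at h
    linarith
  have u₁ : μ.real (Ebc ∩ Eabᶜ) = z - tt := by
    have h := measureReal_inter_add_sdiff (μ := μ) (s := Ebc) mEab
    rw [Set.sdiff_eq, Set.inter_comm Ebc Eab, hT₁] at h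
    linarith
  exact ⟨congrArg μ.real hT₁, congrArg μ.real hT₂, cA, u₃, u₂, u₁, cAB, cAC, cBC, cQ⟩

/-- **`(3PT)` in the Gladkov regime (`t`-form), on every finite weighted graph.**  For `μ = prodBernoulli w`
and vertices `a b c`, write `q = μ(a|b|c)`, `s = μ(ab|c) = μ(a↔b, a↮c)`, `t = μ(ac|b) = μ(a↔c, a↮b)`,
`μ(b isolated) = μ(a↮b, b↮c) = q + t`, `μ(c isolated) = μ(a↮c, b↮c) = q + s`.  If
`q·t/μ(b isolated) ≤ s²/μ(c isolated) + t·μ(a↮b)` then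
`μ(a↔b)·μ(a↮b) ≤ μ(a↔b, a↮c) + μ(a↔c, a↮b) + μ(b↔c, a↮b)`.
Corollary of Gladkov's Lemma 1.2 [cite: Gladkov2024, Lemma 1.2]; the regime hypothesis and the corollary are
[this work]. -/
theorem threePointVariance_of_regime_t (w : Sym2 V → unitInterval) (a b c : V)
    (hR : (prodBernoulli w).real ((openConn a b)ᶜ ∩ (openConn a c)ᶜ ∩ (openConn b c)ᶜ) *
          (prodBernoulli w).real (openConn a c ∩ (openConn a b)ᶜ) /
          (prodBernoulli w).real ((openConn a b)ᶜ ∩ (openConn b c)ᶜ) ≤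
        (prodBernoulli w).real (openConn a b ∩ (openConn a c)ᶜ) ^ 2 /
            (prodBernoulli w).real ((openConn a c)ᶜ ∩ (openConn b c)ᶜ) +
          (prodBernoulli w).real (openConn a c ∩ (openConn a b)ᶜ) * (prodBernoulli w).real (openConn a b)ᶜ) :
    (prodBernoulli w).real (openConn a b) * (prodBernoulli w).real (openConn a b)ᶜ ≤
      (prodBernoulli w).real (openConn a b ∩ (openConn a c)ᶜ) + (prodBernoulli w).real (openConn a c ∩ (openConn a b)ᶜ) +
        (prodBernoulli w).real (openConn b c ∩ (openConn a b)ᶜ) := by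
  classical
  obtain ⟨_, _, cA, u₃, u₂, u₁, cAB, cAC, cBC, cQ⟩ := cells_eq w a b c
  have hL := gladkov2024_lemma_1_2_prodBernoulli w a b c
  -- nonnegativity of the five cells
  have hs : 0 ≤ (prodBernoulli w).real (openConn a b ∩ (openConn a c)ᶜ) := measureReal_nonneg
  have ht : 0 ≤ (prodBernoulli w).real (openConn a c ∩ (openConn a b)ᶜ) := measureReal_nonneg
  have hu : 0 ≤ (prodBernoulli w).real (openConn b c ∩ (openConn a b)ᶜ) := measureReal_nonneg
  have hq : 0 ≤ (prodBernoulli w).real ((openConn a b)ᶜ ∩ (openConn a c)ᶜ ∩ (openConn b c)ᶜ) :=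
    measureReal_nonneg
  rw [u₃] at hs
  rw [u₂] at ht
  rw [u₁] at hu
  rw [cQ] at hq
  rw [cA, u₃, u₂, cAC, cBC, cQ] at hR
  rw [cAB, cAC, cBC, cQ] at hL
  rw [cA, u₃, u₂, u₁]
  -- abbreviate the four basic masses
  set x := (prodBernoulli w).real (openConn a b) with hx
  set y := (prodBernoulli w).real (openConn a c) with hy
  set z := (prodBernoulli w).real (openConn b c) with hz
  set tt := (prodBernoulli w).real (openConn a b ∩ openConn a c) with htt
  -- rewrite the isolation probabilities as sums of cells and apply the algebra
  have eB : 1 - x - z + tt = (1 - x - y - z + 2 * tt) + (y - tt) := by ring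
  have eC : 1 - y - z + tt = (1 - x - y - z + 2 * tt) + (x - tt) := by ring
  have eA : 1 - x - y + tt = (1 - x - y - z + 2 * tt) + (z - tt) := by ring
  rw [eB, eC] at hL hR
  rw [eA] at hL
  have key := regime_algebra (θ := x) (s := x - tt) (t := y - tt) (u := z - tt) (q := 1 - x - y - z + 2 * tt)
    hs ht hu hq (by ring) hL hR
  linarith [key]

/-- **`(3PT)` in the Gladkov regime (`u`-form)**: the `a ↔ b` mirror of `threePointVariance_of_regime_t`
(Lemma 1.2 at the vertex `b`).  With `u = μ(a|bc) = μ(b↔c, a↮b)` and `μ(a isolated) = μ(a↮b, a↮c) = q + u`: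
if `q·u/μ(a isolated) ≤ s²/μ(c isolated) + u·μ(a↮b)` then `(3PT)`.
[cite: Gladkov2024, Lemma 1.2]; corollary [this work]. -/
theorem threePointVariance_of_regime_u (w : Sym2 V → unitInterval) (a b c : V)
    (hR : (prodBernoulli w).real ((openConn a b)ᶜ ∩ (openConn a c)ᶜ ∩ (openConn b c)ᶜ) *
          (prodBernoulli w).real (openConn b c ∩ (openConn a b)ᶜ) /
          (prodBernoulli w).real ((openConn a b)ᶜ ∩ (openConn a c)ᶜ) ≤
        (prodBernoulli w).real (openConn a b ∩ (openConn a c)ᶜ) ^ 2 /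
            (prodBernoulli w).real ((openConn a c)ᶜ ∩ (openConn b c)ᶜ) +
          (prodBernoulli w).real (openConn b c ∩ (openConn a b)ᶜ) * (prodBernoulli w).real (openConn a b)ᶜ) :
    (prodBernoulli w).real (openConn a b) * (prodBernoulli w).real (openConn a b)ᶜ ≤
      (prodBernoulli w).real (openConn a b ∩ (openConn a c)ᶜ) + (prodBernoulli w).real (openConn a c ∩ (openConn a b)ᶜ) +
        (prodBernoulli w).real (openConn b c ∩ (openConn a b)ᶜ) := by
  classical
  -- apply the `t`-form to the triple `(b, a, c)` and translate the events
  have h := threePointVariance_of_regime_t w b a c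
  have e1 : (openConn b a : Set (BondConfig V)) = openConn a b := by
    ext ω
    exact ⟨fun h' => SimpleGraph.Reachable.symm h', fun h' => SimpleGraph.Reachable.symm h'⟩
  -- `{b↔a} ∩ {b↔c}ᶜ = {a↔b} ∩ {a↔c}ᶜ`:  `ab ∧ ¬bc ↔ ab ∧ ¬ac`
  have e2 : (openConn b a ∩ (openConn b c)ᶜ : Set (BondConfig V)) = openConn a b ∩ (openConn a c)ᶜ := by
    ext ω
    simp only [Set.mem_inter_iff, Set.mem_compl_iff]
    constructor
    · rintro ⟨hba, hbc⟩
      exact ⟨SimpleGraph.Reachable.symm hba, fun hac => hbc (SimpleGraph.Reachable.trans hba hac)⟩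
    · rintro ⟨hab, hac⟩
      exact ⟨SimpleGraph.Reachable.symm hab, fun hbc => hac (SimpleGraph.Reachable.trans hab hbc)⟩
  -- `{b↔a}ᶜ ∩ {b↔c}ᶜ ∩ {a↔c}ᶜ = {a↔b}ᶜ ∩ {a↔c}ᶜ ∩ {b↔c}ᶜ`
  have e3 : ((openConn b a)ᶜ ∩ (openConn b c)ᶜ ∩ (openConn a c)ᶜ : Set (BondConfig V)) =
      (openConn a b)ᶜ ∩ (openConn a c)ᶜ ∩ (openConn b c)ᶜ := by
    rw [e1]
    ext ω
    simp only [Set.mem_inter_iff, Set.mem_compl_iff]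
    tauto
  -- `{b↔c} ∩ {b↔a}ᶜ`, `{a↔c} ∩ {b↔a}ᶜ`, `{b↔a}ᶜ ∩ {a↔c}ᶜ`, `{b↔c}ᶜ ∩ {a↔c}ᶜ`
  have e4 : (openConn b c ∩ (openConn b a)ᶜ : Set (BondConfig V)) = openConn b c ∩ (openConn a b)ᶜ := by rw [e1]
  have e5 : (openConn a c ∩ (openConn b a)ᶜ : Set (BondConfig V)) = openConn a c ∩ (openConn a b)ᶜ := by rw [e1]
  have e6 : ((openConn b a)ᶜ ∩ (openConn a c)ᶜ : Set (BondConfig V)) = (openConn a b)ᶜ ∩ (openConn a c)ᶜ := by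
    rw [e1]
  have e7 : ((openConn b c)ᶜ ∩ (openConn a c)ᶜ : Set (BondConfig V)) = (openConn a c)ᶜ ∩ (openConn b c)ᶜ :=
    Set.inter_comm _ _
  rw [e2, e3, e4, e5, e6, e7, e1] at h
  have h' := h hR
  linarith [h']

end Summit.CriticalPhenomena.PercolationContinuityZ3.Theorems.ThreePointVarianceGladkovRegime
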